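import Literature.NumberTheory.Sieve.HardyLittlewoodChowlaSieve
import Literature.NumberTheory.Sieve.HardyLittlewoodChowlaSingular
import Literature.NumberTheory.LFunctions.MatomakiRadziwillTaoTypical
import HarnessLib

/-!
# Hardy–Littlewood–Chowla on average (Lichtman–Teräväinen 2022): removing the atypical integers

Topic `Literature/NumberTheory/Sieve`, companion of `HardyLittlewoodChowla.lean` (the named facts
`lichtmanTeravainen2022_hlc_avg(_liouville)` = J. D. Lichtman, J. Teräväinen, *On the
Hardy–Littlewood–Chowla conjecture on average*, Forum Math. Sigma 10 (2022) e57, arXiv:2111.08912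
[LichtmanTeravainen2022], Theorem 1.2 (i)), of `HardyLittlewoodChowlaSieve.lean` (Lemma 2.11:
`sum_indicator_prod_vonMangoldt_le`) and `HardyLittlewoodChowlaSingular.lean` (Lemma 2.5:
`sum_weight_shift_le`).  Everything in this file is PROVED; it introduces no definition and no
named fact.

This is the first display of **§4, proof of Theorem 1.6** of the paper (held copy
`paper:arxiv-2111.08912`, p. 11): "we see that `f₁(n) = λ(n) 𝟙_𝒮(n)` satisfies …  Thus by Lemma 2.5,
the bound (2.13), and Lemma 2.11 … we may add back in `n + h ∉ 𝒮` into (4.3) at the cost of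
`O(δ)`: `∑_{h ≤ H} ∑_{n ≤ X, n+h ∉ 𝒮} ∏ⱼ Λ(n + aⱼ) ≪ XH ∑_{P₁ ≤ P_j ≤ exp(√log X)} log P_j/log Q_j
≪ XH · log P₁/log Q₁ · ∑_j j⁻² ≪ δ XH`", with `𝒮 = 𝒮_{P₁,Q₁,X₀,·}` the typical factorisations of
[MRT2015, Def. 2.1] (`Literature.NumberTheory.LFunctions.MRT2015.IsTypical`):

* `LichtmanTeravainen2022.Liouville.sum_singularShift_le` — Lemma 2.5 in the form needed here:
  `∑_{h ≤ H, h ∉ A} ∏_{a ∈ A} |h−a|/φ(|h−a|) ≤ C(A) (H + 1)`;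
* `LichtmanTeravainen2022.Liouville.exceptional_sum_le` — for fixed `A` there are `C, X₁` with
  `∑_{h ≤ H} ∑_{n ≤ X, n+h ∉ 𝒮} ∏_{a ∈ A} Λ(n+a) ≤ C (H X log P₁/log Q₁ + X + H X^{7/8})`
  whenever `X ≥ X₁`, `10 < P₁ ≤ Q₁ ≤ X`, `0 < X₀ ≤ X` and `exp(√(log X₀)) ≤ X^{1/4}` (union bound
  over the scales `j` with `log P_j/log Q_j = (log P₁/log Q₁)/j²`, `∑ j⁻² ≤ 2`, at most `√(log X₀)`
  scales, exactly as in the tree's proof of [MRT2015, Lemma 2.2], `MRT2015.lemma22`; the `≤ #A`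
  shifts `h ∈ A` are bounded by Lemma 2.3, `sum_prod_vonMangoldt_le`).

## References

* J. D. Lichtman, J. Teräväinen, Forum Math. Sigma 10 (2022) e57, arXiv:2111.08912, §4 (proof of
  Theorem 1.6, first display), Lemmas 2.5 and 2.11. [cite: LichtmanTeravainen2022, §4]
* K. Matomäki, M. Radziwiłł, T. Tao, Algebra & Number Theory 9 (2015), Definition 2.1, Lemma 2.2.
  [cite: MatomakiRadziwillTao2015, Lemma 2.2]
-/

noncomputable section

open Finset
open scoped ArithmeticFunction.vonMangoldt

namespace Literature.NumberTheory.Sieve.LichtmanTeravainen2022.Liouville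

open Literature.NumberTheory.LFunctions.MRT2015 (IsTypical HasFactorIn seqP seqQ seqQ_pos
  index_le_sqrt_log seqP_le_seqQ le_seqP log_seqP_div_log_seqQ)

/-! ### The two notions "has a prime factor in `[P, Q]`" -/

/-- `Lichtman2020.HasPrimeFactorIn P Q m → MRT2015.HasFactorIn m P Q`. [folklore] -/
theorem hasFactorIn_of_hasPrimeFactorIn {P Q : ℝ} {m : ℕ} (h : HasPrimeFactorIn P Q m) :
    HasFactorIn m P Q := by
  obtain ⟨p, hp, hP, hQ⟩ := h
  exact ⟨p, Nat.prime_of_mem_primeFactors hp, Nat.dvd_of_mem_primeFactors hp, hP, hQ⟩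

/-! ### Lemma 2.5 for the shift weights of Lemma 2.11 -/

/-- For `h ≠ a` the weight `|h − a|/φ(|h − a|)` is `≥ 1`. [folklore] -/
theorem one_le_natAbs_div_totient {h a : ℕ} (hne : h ≠ a) :
    (1 : ℝ) ≤ ((((h : ℤ) - a).natAbs : ℕ) : ℝ) / Nat.totient (((h : ℤ) - a).natAbs) := by
  set d : ℕ := ((h : ℤ) - a).natAbs with hd
  have hd0 : d ≠ 0 := by
    rw [hd, Ne, Int.natAbs_eq_zero, sub_eq_zero, Nat.cast_inj]; exact hne
  have hφ0 : 0 < Nat.totient d := Nat.totient_pos.2 (Nat.pos_of_ne_zero hd0)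
  rw [le_div_iff₀ (by exact_mod_cast hφ0), one_mul]
  exact_mod_cast Nat.totient_le d

/-- **Lemma 2.5 for the weights `∏_{a ∈ A} |h−a|/φ(|h−a|)`**: for fixed `A` there is `C` with
`∑_{h ≤ H, h ∉ A} ∏_{a ∈ A} |h−a|/φ(|h−a|) ≤ C (H + 1)` for all `H` (`∏ ≤ ∑_a (·)^{#A}` since every
factor is `≥ 1`, then `sum_weight_shift_le` along `h ↦ h − a`).
[cite: LichtmanTeravainen2022, Lemma 2.5] -/
theorem sum_singularShift_le (A : Finset ℕ) : ∃ C : ℝ, 0 < C ∧ ∀ H : ℕ,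
    ∑ h ∈ (Icc 1 H).filter (fun h => h ∉ A),
        ∏ a ∈ A, ((((h : ℤ) - a).natAbs : ℕ) : ℝ) / Nat.totient (((h : ℤ) - a).natAbs) ≤
      C * ((H : ℝ) + 1) := by
  classical
  rcases A.eq_empty_or_nonempty with rfl | hA
  · refine ⟨1, one_pos, fun H => ?_⟩
    simp only [Finset.prod_empty, Finset.sum_const, nsmul_eq_mul, mul_one, one_mul]
    calc (#((Icc 1 H).filter (fun h => h ∉ (∅ : Finset ℕ))) : ℝ) ≤ #(Icc 1 H) := by
          exact_mod_cast Finset.card_filter_le _ _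
      _ = H := by simp
      _ ≤ (H : ℝ) + 1 := by linarith
  obtain ⟨C₁, hC₁, h1⟩ := sum_weight_shift_le #A
  refine ⟨C₁ * #A * ((A.sup id : ℕ) + 1), by positivity, fun H => ?_⟩
  set wt : ℕ → ℕ → ℝ := fun h a =>
    ((((h : ℤ) - a).natAbs : ℕ) : ℝ) / Nat.totient (((h : ℤ) - a).natAbs) with hwt
  -- `∏ ≤ ∑ (·)^{#A}`
  have hstep : ∀ h ∈ (Icc 1 H).filter (fun h => h ∉ A),
      ∏ a ∈ A, wt h a ≤ ∑ a ∈ A, wt h a ^ #A := by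
    intro h hh
    have hhA : h ∉ A := (Finset.mem_filter.1 hh).2
    exact prod_le_sum_pow_card A hA (wt h) fun a ha =>
      one_le_natAbs_div_totient (fun hEq => hhA (hEq ▸ ha))
  -- each `a`: Lemma 2.5 along `h ↦ h - a`
  have hcol : ∀ a ∈ A, ∑ h ∈ (Icc 1 H).filter (fun h => h ∉ A), wt h a ^ #A ≤
      C₁ * ((H : ℝ) + (A.sup id : ℕ) + 1) := by
    intro a ha
    have haA : (a : ℝ) ≤ (A.sup id : ℕ) := by exact_mod_cast Finset.le_sup (f := id) ha
    calc ∑ h ∈ (Icc 1 H).filter (fun h => h ∉ A), wt h a ^ #A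
        ≤ ∑ h ∈ Icc 1 H, wt h a ^ #A :=
          Finset.sum_le_sum_of_subset_of_nonneg (Finset.filter_subset _ _) fun h _ _ => by
            positivity
      _ ≤ ∑ u ∈ Icc 1 H, (max 1 ((((u : ℤ) + -(a : ℤ)).natAbs : ℝ) /
            Nat.totient ((u : ℤ) + -(a : ℤ)).natAbs)) ^ #A := by
          refine Finset.sum_le_sum fun u _ => pow_le_pow_left₀ (by positivity) ?_ _
          rw [← sub_eq_add_neg]
          exact le_max_right _ _
      _ ≤ C₁ * ((H : ℝ) + |((-(a : ℤ) : ℤ) : ℝ)| + 1) := h1 H (-(a : ℤ))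
      _ = C₁ * ((H : ℝ) + a + 1) := by
          congr 2; push_cast; rw [abs_neg, Nat.abs_cast]
      _ ≤ C₁ * ((H : ℝ) + (A.sup id : ℕ) + 1) := by gcongr
  calc ∑ h ∈ (Icc 1 H).filter (fun h => h ∉ A), ∏ a ∈ A, wt h a
      ≤ ∑ h ∈ (Icc 1 H).filter (fun h => h ∉ A), ∑ a ∈ A, wt h a ^ #A := Finset.sum_le_sum hstep
    _ = ∑ a ∈ A, ∑ h ∈ (Icc 1 H).filter (fun h => h ∉ A), wt h a ^ #A := Finset.sum_comm
    _ ≤ ∑ _a ∈ A, C₁ * ((H : ℝ) + (A.sup id : ℕ) + 1) := Finset.sum_le_sum hcol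
    _ = #A * (C₁ * ((H : ℝ) + (A.sup id : ℕ) + 1)) := by rw [Finset.sum_const, nsmul_eq_mul]
    _ ≤ C₁ * #A * ((A.sup id : ℕ) + 1) * ((H : ℝ) + 1) := by
        have h0 : (0 : ℝ) ≤ (A.sup id : ℕ) := Nat.cast_nonneg _
        have hH : (0 : ℝ) ≤ H := Nat.cast_nonneg _
        have hA0 : (0 : ℝ) ≤ #A := Nat.cast_nonneg _
        nlinarith [mul_nonneg (mul_nonneg hC₁.le hA0) (mul_nonneg h0 hH)]

/-! ### §4, first display: the atypical `n + h` -/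

open scoped Classical in
set_option maxHeartbeats 800000 in
/-- **[LichtmanTeravainen2022, §4 (proof of Theorem 1.6), first display]**: for a fixed set `A`
of shifts there are `C, X₁` such that for all `X ≥ X₁`, `H`, and `10 < P₁ ≤ Q₁ ≤ X`, `0 < X₀ ≤ X`
with `exp(√(log X₀)) ≤ X^{1/4}`, writing `𝒮` for the integers with typical factorisation
(`MRT2015.IsTypical P₁ Q₁ X₀`: a prime factor in every `[P_j, Q_j]`, `Q_j ≤ exp(√(log X₀))`),
`∑_{h=1}^{H} ∑_{n ≤ X, n+h ∉ 𝒮} ∏_{a ∈ A} Λ(n+a) ≤ C (H X log P₁/log Q₁ + X + H X^{7/8})`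
(printed: "`≪ XH ∑_j log P_j/log Q_j ≪ XH (log P₁/log Q₁) ∑_j j⁻² ≪ δ XH`"; the terms `X` and
`H X^{7/8}` account for the `≤ #A` shifts `h ∈ A` and for the sieve remainders).
[cite: LichtmanTeravainen2022, §4 (proof of Theorem 1.6)] -/
theorem exceptional_sum_le (A : Finset ℕ) : ∃ C X₁ : ℝ, 0 < C ∧
    ∀ (X H : ℕ) (P₁ Q₁ X₀ : ℝ), X₁ ≤ X → 10 < P₁ → P₁ ≤ Q₁ → Q₁ ≤ X → 0 < X₀ → X₀ ≤ X →
      Real.exp (Real.sqrt (Real.log X₀)) ≤ (X : ℝ) ^ (1 / 4 : ℝ) → A.sup id ≤ X →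
      ∑ h ∈ Icc 1 H, ∑ n ∈ Icc 1 X,
          (if IsTypical P₁ Q₁ X₀ (n + h) then (0 : ℝ) else ∏ a ∈ A, Λ (n + a)) ≤
        C * (H * X * (Real.log P₁ / Real.log Q₁) + X + H * (X : ℝ) ^ (7 / 8 : ℝ)) := by
  obtain ⟨C₁, hC₁, h211⟩ := sum_indicator_prod_vonMangoldt_le #A
  obtain ⟨C₂, hC₂, h23⟩ := sum_prod_vonMangoldt_le #A
  obtain ⟨C₃, hC₃, hsing⟩ := sum_singularShift_le A
  -- the singular-series factor of `A` (a constant)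
  set S : ℝ := (∏ x ∈ A.offDiag, ((((x.1 : ℤ) - x.2).natAbs : ℕ) : ℝ) /
    Nat.totient (((x.1 : ℤ) - x.2).natAbs)) ^ #A with hS
  have hS0 : 0 ≤ S := by rw [hS]; positivity
  set K : ℝ := 2 * C₁ * S * C₃ * ((A.sup id : ℕ) + 2) + #A * C₂ * (S + 1) + 2 * C₁ + 1 with hK
  refine ⟨K, 16, by positivity, ?_⟩
  intro X H P₁ Q₁ X₀ hX hP₁ hPQ hQX hX₀ hX₀X hE hAX
  -- sizes
  have hX16 : (16 : ℝ) ≤ X := hX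
  have hX0 : (0 : ℝ) < X := by linarith
  have hX1 : (1 : ℝ) ≤ X := by linarith
  have hP2 : (2 : ℝ) ≤ P₁ := by linarith
  have hlogP : 0 < Real.log P₁ := Real.log_pos (by linarith)
  have hlog10 : (2 : ℝ) ≤ Real.log 10 := by
    have h9 : Real.exp 2 ≤ 10 := by
      have := Real.exp_one_lt_d9
      have h' : Real.exp 2 = Real.exp 1 * Real.exp 1 := by rw [← Real.exp_add]; norm_num
      nlinarith [Real.exp_pos 1]
    calc (2 : ℝ) = Real.log (Real.exp 2) := (Real.log_exp 2).symm
      _ ≤ Real.log 10 := Real.log_le_log (Real.exp_pos _) h9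
  have hlogP2 : 2 ≤ Real.log P₁ := hlog10.trans (Real.log_le_log (by norm_num) hP₁.le)
  have hlogPQ : Real.log P₁ ≤ Real.log Q₁ := Real.log_le_log (by linarith) hPQ
  have hlogQ1 : 1 ≤ Real.log Q₁ := by linarith
  have hlogQ0 : 0 < Real.log Q₁ := by linarith
  have hQ0 : 0 < Q₁ := by linarith
  set ρ : ℝ := Real.log P₁ / Real.log Q₁ with hρ
  have hρ0 : 0 ≤ ρ := by positivity
  have hρ1 : ρ ≤ 1 := div_le_one_of_le₀ hlogPQ hlogQ0.le
  have hAX' : ∀ a ∈ A, a ≤ X := fun a ha => (Finset.le_sup (f := id) ha).trans hAX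
  -- the scales
  set E := Real.exp (Real.sqrt (Real.log X₀)) with hEdef
  set Jm := ⌊Real.sqrt (Real.log X₀)⌋₊ with hJm
  set Js := (Icc 1 Jm).filter fun j => seqQ Q₁ j ≤ E with hJs
  have hJs_card : (#Js : ℝ) ≤ Real.sqrt (Real.log X) := by
    calc (#Js : ℝ) ≤ #(Icc 1 Jm) := by exact_mod_cast Finset.card_filter_le _ _
      _ = Jm := by simp
      _ ≤ Real.sqrt (Real.log X₀) := Nat.floor_le (Real.sqrt_nonneg _)
      _ ≤ Real.sqrt (Real.log X) := Real.sqrt_le_sqrt (Real.log_le_log hX₀ hX₀X)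
  -- `√(log X) ≤ 2 X^{1/8}` and `X^{3/4} · X^{1/8} = X^{7/8}`
  have hsqrtlog : Real.sqrt (Real.log X) ≤ 2 * (X : ℝ) ^ (1 / 8 : ℝ) := by
    have h1 : Real.log X ≤ 4 * (X : ℝ) ^ (1 / 4 : ℝ) := by
      have := Real.log_le_sub_one_of_pos (Real.rpow_pos_of_pos hX0 (1 / 4))
      rw [Real.log_rpow hX0] at this
      linarith
    have h2 : (2 * (X : ℝ) ^ (1 / 8 : ℝ)) ^ 2 = 4 * (X : ℝ) ^ (1 / 4 : ℝ) := by
      rw [mul_pow, ← Real.rpow_natCast ((X : ℝ) ^ (1 / 8 : ℝ)) 2, ← Real.rpow_mul hX0.le]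
      norm_num
    rw [show Real.sqrt (Real.log X) = Real.sqrt (Real.log X) by rfl]
    calc Real.sqrt (Real.log X) ≤ Real.sqrt (4 * (X : ℝ) ^ (1 / 4 : ℝ)) := Real.sqrt_le_sqrt h1
      _ = 2 * (X : ℝ) ^ (1 / 8 : ℝ) := by
          rw [← h2, Real.sqrt_sq (by positivity)]
  have hX78 : (X : ℝ) ^ (3 / 4 : ℝ) * (X : ℝ) ^ (1 / 8 : ℝ) = (X : ℝ) ^ (7 / 8 : ℝ) := by
    rw [← Real.rpow_add hX0]; norm_num
  have hX34_le : (X : ℝ) ^ (3 / 4 : ℝ) ≤ X := by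
    conv_rhs => rw [← Real.rpow_one (X : ℝ)]
    exact Real.rpow_le_rpow_of_exponent_le hX1 (by norm_num)
  have hX34_0 : 0 ≤ (X : ℝ) ^ (3 / 4 : ℝ) := by positivity
  -- abbreviations
  set ΛA : ℕ → ℝ := fun n => ∏ a ∈ A, Λ (n + a) with hΛA
  have hΛA0 : ∀ n, 0 ≤ ΛA n := fun n =>
    Finset.prod_nonneg fun a _ => ArithmeticFunction.vonMangoldt_nonneg
  set D : ℕ → ℝ := fun h =>
    ∏ a ∈ A, (((((h : ℤ) - a).natAbs : ℕ) : ℝ) / Nat.totient (((h : ℤ) - a).natAbs)) with hD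
  have hD0 : ∀ h, 0 ≤ D h := fun h => by rw [hD]; positivity
  set inner : ℕ → ℝ := fun h =>
    ∑ n ∈ Icc 1 X, (if IsTypical P₁ Q₁ X₀ (n + h) then (0 : ℝ) else ΛA n) with hinner
  -- Case `h ∉ A`
  have hcase1 : ∀ h, h ∉ A → inner h ≤ 2 * C₁ * S * ρ * X * D h + C₁ * #Js * (X : ℝ) ^ (3 / 4 : ℝ) := by
    intro h hhA
    -- union bound over the scales
    have hpt : ∀ n ∈ Icc 1 X, (if IsTypical P₁ Q₁ X₀ (n + h) then (0 : ℝ) else ΛA n) ≤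
        ∑ j ∈ Js, (if HasPrimeFactorIn (seqP P₁ Q₁ j) (seqQ Q₁ j) (n + h) then (0 : ℝ)
          else ΛA n) := by
      intro n hn
      have hterm0 : ∀ j, (0 : ℝ) ≤ (if HasPrimeFactorIn (seqP P₁ Q₁ j) (seqQ Q₁ j) (n + h)
          then (0 : ℝ) else ΛA n) := fun j => by split_ifs; exacts [le_rfl, hΛA0 n]
      split_ifs with htyp
      · exact Finset.sum_nonneg fun j _ => hterm0 j
      · simp only [IsTypical, not_forall, exists_prop] at htyp
        obtain ⟨j, hj1, hjE, hjn⟩ := htyp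
        have hjJs : j ∈ Js := by
          rw [hJs, Finset.mem_filter, Finset.mem_Icc]
          exact ⟨⟨hj1, Nat.le_floor (index_le_sqrt_log hj1 hQ0 hlogQ1 hjE)⟩, hjE⟩
        have hnot : ¬ HasPrimeFactorIn (seqP P₁ Q₁ j) (seqQ Q₁ j) (n + h) :=
          fun hh => hjn (hasFactorIn_of_hasPrimeFactorIn hh)
        calc ΛA n = (if HasPrimeFactorIn (seqP P₁ Q₁ j) (seqQ Q₁ j) (n + h) then (0 : ℝ)
              else ΛA n) := by rw [if_neg hnot]
          _ ≤ _ := Finset.single_le_sum (fun j _ => hterm0 j) hjJs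
    -- each scale: Lemma 2.11
    have hscale : ∀ j ∈ Js, ∑ n ∈ Icc 1 X,
        (if HasPrimeFactorIn (seqP P₁ Q₁ j) (seqQ Q₁ j) (n + h) then (0 : ℝ) else ΛA n) ≤
          C₁ * (X * S * (ρ / (j : ℝ) ^ 2) * D h + (X : ℝ) ^ (3 / 4 : ℝ)) := by
      intro j hj
      rw [hJs, Finset.mem_filter, Finset.mem_Icc] at hj
      obtain ⟨⟨hj1, -⟩, hjE⟩ := hj
      have hPj : 2 ≤ seqP P₁ Q₁ j := hP2.trans (le_seqP (by linarith) hlogQ1)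
      have hPQj : seqP P₁ Q₁ j ≤ seqQ Q₁ j := seqP_le_seqQ hj1 hlogP.le hlogPQ hPQ
      have hQjX : seqQ Q₁ j ≤ (X : ℝ) ^ (1 / 4 : ℝ) := hjE.trans hE
      have h := h211 X A h (seqP P₁ Q₁ j) (seqQ Q₁ j) le_rfl hAX' hhA hPj hPQj hQjX
      rw [log_seqP_div_log_seqQ hj1 hlogQ0.ne'] at h
      simpa only [hΛA, hD, hS, hρ] using h
    have hsum_inv_sq : ∑ j ∈ Js, ((j : ℝ) ^ 2)⁻¹ ≤ 2 := by
      calc ∑ j ∈ Js, ((j : ℝ) ^ 2)⁻¹ ≤ ∑ j ∈ Ioo 0 (Jm + 1), ((j : ℝ) ^ 2)⁻¹ := by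
            refine Finset.sum_le_sum_of_subset_of_nonneg ?_ fun j _ _ => by positivity
            intro j hj
            rw [hJs, Finset.mem_filter, Finset.mem_Icc] at hj
            rw [Finset.mem_Ioo]; omega
        _ ≤ 2 / ((0 : ℕ) + 1 : ℝ) := sum_Ioo_inv_sq_le 0 (Jm + 1)
        _ = 2 := by norm_num
    calc inner h ≤ ∑ n ∈ Icc 1 X, ∑ j ∈ Js,
          (if HasPrimeFactorIn (seqP P₁ Q₁ j) (seqQ Q₁ j) (n + h) then (0 : ℝ) else ΛA n) :=
          Finset.sum_le_sum hpt
      _ = ∑ j ∈ Js, ∑ n ∈ Icc 1 X,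
          (if HasPrimeFactorIn (seqP P₁ Q₁ j) (seqQ Q₁ j) (n + h) then (0 : ℝ) else ΛA n) :=
          Finset.sum_comm
      _ ≤ ∑ j ∈ Js, C₁ * (X * S * (ρ / (j : ℝ) ^ 2) * D h + (X : ℝ) ^ (3 / 4 : ℝ)) :=
          Finset.sum_le_sum hscale
      _ = ∑ j ∈ Js, ((C₁ * X * S * ρ * D h) * ((j : ℝ) ^ 2)⁻¹ + C₁ * (X : ℝ) ^ (3 / 4 : ℝ)) := by
          refine Finset.sum_congr rfl fun j _ => ?_
          rw [div_eq_mul_inv]; ring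
      _ = C₁ * X * S * ρ * D h * ∑ j ∈ Js, ((j : ℝ) ^ 2)⁻¹ + C₁ * #Js * (X : ℝ) ^ (3 / 4 : ℝ) := by
          rw [Finset.sum_add_distrib, ← Finset.mul_sum, Finset.sum_const, nsmul_eq_mul]; ring
      _ ≤ C₁ * X * S * ρ * D h * 2 + C₁ * #Js * (X : ℝ) ^ (3 / 4 : ℝ) := by
          have : 0 ≤ C₁ * X * S * ρ * D h := by
            have := hD0 h; positivity
          nlinarith [hsum_inv_sq]
      _ = 2 * C₁ * S * ρ * X * D h + C₁ * #Js * (X : ℝ) ^ (3 / 4 : ℝ) := by ring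
  -- Case `h ∈ A`: Lemma 2.3
  have hcase2 : ∀ h, h ∈ A → inner h ≤ C₂ * (X * S + (X : ℝ) ^ (3 / 4 : ℝ)) := by
    intro h _
    calc inner h ≤ ∑ n ∈ Icc 1 X, ΛA n := Finset.sum_le_sum fun n _ => by
            split_ifs; exacts [hΛA0 n, le_rfl]
      _ ≤ C₂ * (X * S + (X : ℝ) ^ (3 / 4 : ℝ)) := by
          have := h23 X A le_rfl hAX'
          simpa only [hΛA, hS] using this
  -- sum over `h ∉ A`
  have hIn1 : ∑ h ∈ (Icc 1 H).filter (fun h => h ∉ A), inner h ≤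
      2 * C₁ * S * C₃ * ρ * X * ((H : ℝ) + 1) + 2 * C₁ * H * (X : ℝ) ^ (7 / 8 : ℝ) := by
    have hcardH : (#((Icc 1 H).filter (fun h => h ∉ A)) : ℝ) ≤ H := by
      calc (#((Icc 1 H).filter (fun h => h ∉ A)) : ℝ) ≤ #(Icc 1 H) := by
            exact_mod_cast Finset.card_filter_le _ _
        _ = H := by simp
    have h3 : C₁ * Real.sqrt (Real.log X) * (X : ℝ) ^ (3 / 4 : ℝ) ≤
        2 * C₁ * (X : ℝ) ^ (7 / 8 : ℝ) := by
      calc C₁ * Real.sqrt (Real.log X) * (X : ℝ) ^ (3 / 4 : ℝ)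
          ≤ C₁ * (2 * (X : ℝ) ^ (1 / 8 : ℝ)) * (X : ℝ) ^ (3 / 4 : ℝ) :=
            mul_le_mul_of_nonneg_right (mul_le_mul_of_nonneg_left hsqrtlog hC₁.le) hX34_0
        _ = 2 * C₁ * (X : ℝ) ^ (7 / 8 : ℝ) := by rw [← hX78]; ring
    calc ∑ h ∈ (Icc 1 H).filter (fun h => h ∉ A), inner h
        ≤ ∑ h ∈ (Icc 1 H).filter (fun h => h ∉ A),
          (2 * C₁ * S * ρ * X * D h + C₁ * #Js * (X : ℝ) ^ (3 / 4 : ℝ)) :=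
          Finset.sum_le_sum fun h hh => hcase1 h (Finset.mem_filter.1 hh).2
      _ = 2 * C₁ * S * ρ * X * ∑ h ∈ (Icc 1 H).filter (fun h => h ∉ A), D h +
            #((Icc 1 H).filter (fun h => h ∉ A)) * (C₁ * #Js * (X : ℝ) ^ (3 / 4 : ℝ)) := by
          rw [Finset.sum_add_distrib, ← Finset.mul_sum, Finset.sum_const, nsmul_eq_mul]
      _ ≤ 2 * C₁ * S * ρ * X * (C₃ * ((H : ℝ) + 1)) +
            H * (C₁ * Real.sqrt (Real.log X) * (X : ℝ) ^ (3 / 4 : ℝ)) := by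
          refine add_le_add ?_ ?_
          · exact mul_le_mul_of_nonneg_left (hsing H) (by positivity)
          · have h2 : C₁ * #Js * (X : ℝ) ^ (3 / 4 : ℝ) ≤
                C₁ * Real.sqrt (Real.log X) * (X : ℝ) ^ (3 / 4 : ℝ) :=
              mul_le_mul_of_nonneg_right (mul_le_mul_of_nonneg_left hJs_card hC₁.le) hX34_0
            exact mul_le_mul hcardH h2 (by positivity) (Nat.cast_nonneg _)
      _ ≤ 2 * C₁ * S * C₃ * ρ * X * ((H : ℝ) + 1) + 2 * C₁ * H * (X : ℝ) ^ (7 / 8 : ℝ) := by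
          have hH0 : (0 : ℝ) ≤ H := Nat.cast_nonneg _
          have := mul_le_mul_of_nonneg_left h3 hH0
          nlinarith
  -- sum over `h ∈ A`
  have hIn2 : ∑ h ∈ (Icc 1 H).filter (fun h => ¬ (h ∉ A)), inner h ≤ #A * C₂ * (S + 1) * X := by
    have hsub : (Icc 1 H).filter (fun h => ¬ (h ∉ A)) ⊆ A := fun h hh => by
      simpa using (Finset.mem_filter.1 hh).2
    calc ∑ h ∈ (Icc 1 H).filter (fun h => ¬ (h ∉ A)), inner h
        ≤ ∑ _h ∈ (Icc 1 H).filter (fun h => ¬ (h ∉ A)), C₂ * (X * S + (X : ℝ) ^ (3 / 4 : ℝ)) :=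
          Finset.sum_le_sum fun h hh => hcase2 h (hsub hh)
      _ = #((Icc 1 H).filter (fun h => ¬ (h ∉ A))) * (C₂ * (X * S + (X : ℝ) ^ (3 / 4 : ℝ))) := by
          rw [Finset.sum_const, nsmul_eq_mul]
      _ ≤ #A * (C₂ * (X * S + (X : ℝ) ^ (3 / 4 : ℝ))) := by
          refine mul_le_mul_of_nonneg_right ?_ (by positivity)
          exact_mod_cast Finset.card_le_card hsub
      _ ≤ #A * C₂ * (S + 1) * X := by
          have h1 : X * S + (X : ℝ) ^ (3 / 4 : ℝ) ≤ (S + 1) * X := by nlinarith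
          have h0 : (0 : ℝ) ≤ #A * C₂ := by positivity
          calc (#A : ℝ) * (C₂ * (X * S + (X : ℝ) ^ (3 / 4 : ℝ)))
              = (#A * C₂) * (X * S + (X : ℝ) ^ (3 / 4 : ℝ)) := by ring
            _ ≤ (#A * C₂) * ((S + 1) * X) := mul_le_mul_of_nonneg_left h1 h0
            _ = #A * C₂ * (S + 1) * X := by ring
  -- total
  have htot : ∑ h ∈ Icc 1 H, inner h ≤ K * (H * X * ρ + X + H * (X : ℝ) ^ (7 / 8 : ℝ)) := by
    rw [← Finset.sum_filter_add_sum_filter_not (Icc 1 H) (fun h => h ∉ A)]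
    have hH0 : (0 : ℝ) ≤ H := Nat.cast_nonneg _
    have h78 : (0 : ℝ) ≤ (X : ℝ) ^ (7 / 8 : ℝ) := by positivity
    have hK1 : 2 * C₁ * S * C₃ ≤ K := by
      rw [hK]
      have : (0 : ℝ) ≤ 2 * C₁ * S * C₃ * ((A.sup id : ℕ) + 1) := by positivity
      nlinarith [mul_nonneg (Nat.cast_nonneg #A) (mul_nonneg hC₂.le (by positivity : (0:ℝ) ≤ S + 1))]
    have hK2 : 2 * C₁ * S * C₃ * ρ + #A * C₂ * (S + 1) ≤ K := by
      rw [hK]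
      have h1 : 2 * C₁ * S * C₃ * ρ ≤ 2 * C₁ * S * C₃ := by
        have : (0 : ℝ) ≤ 2 * C₁ * S * C₃ := by positivity
        nlinarith
      have : (0 : ℝ) ≤ 2 * C₁ * S * C₃ * ((A.sup id : ℕ) + 1) := by positivity
      nlinarith
    have hK3 : 2 * C₁ ≤ K := by
      rw [hK]
      have : (0 : ℝ) ≤ 2 * C₁ * S * C₃ * ((A.sup id : ℕ) + 2) := by positivity
      have : (0 : ℝ) ≤ #A * C₂ * (S + 1) := by positivity
      nlinarith
    have hT1 : 2 * C₁ * S * C₃ * ρ * X * (H : ℝ) ≤ K * (H * X * ρ) := by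
      have : (0 : ℝ) ≤ H * X * ρ := by positivity
      calc 2 * C₁ * S * C₃ * ρ * X * (H : ℝ) = (2 * C₁ * S * C₃) * (H * X * ρ) := by ring
        _ ≤ K * (H * X * ρ) := mul_le_mul_of_nonneg_right hK1 this
    have hT2 : 2 * C₁ * S * C₃ * ρ * X + #A * C₂ * (S + 1) * X ≤ K * X := by
      calc 2 * C₁ * S * C₃ * ρ * X + #A * C₂ * (S + 1) * X
          = (2 * C₁ * S * C₃ * ρ + #A * C₂ * (S + 1)) * X := by ring
        _ ≤ K * X := mul_le_mul_of_nonneg_right hK2 hX0.le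
    have hT3 : 2 * C₁ * H * (X : ℝ) ^ (7 / 8 : ℝ) ≤ K * (H * (X : ℝ) ^ (7 / 8 : ℝ)) := by
      calc 2 * C₁ * H * (X : ℝ) ^ (7 / 8 : ℝ) = (2 * C₁) * (H * (X : ℝ) ^ (7 / 8 : ℝ)) := by ring
        _ ≤ K * (H * (X : ℝ) ^ (7 / 8 : ℝ)) := mul_le_mul_of_nonneg_right hK3 (by positivity)
    calc ∑ h ∈ (Icc 1 H).filter (fun h => h ∉ A), inner h +
          ∑ h ∈ (Icc 1 H).filter (fun h => ¬ (h ∉ A)), inner h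
        ≤ (2 * C₁ * S * C₃ * ρ * X * ((H : ℝ) + 1) + 2 * C₁ * H * (X : ℝ) ^ (7 / 8 : ℝ)) +
            #A * C₂ * (S + 1) * X := add_le_add hIn1 hIn2
      _ = 2 * C₁ * S * C₃ * ρ * X * (H : ℝ) + (2 * C₁ * S * C₃ * ρ * X + #A * C₂ * (S + 1) * X) +
            2 * C₁ * H * (X : ℝ) ^ (7 / 8 : ℝ) := by ring
      _ ≤ K * (H * X * ρ) + K * X + K * (H * (X : ℝ) ^ (7 / 8 : ℝ)) :=
          add_le_add (add_le_add hT1 hT2) hT3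
      _ = K * (H * X * ρ + X + H * (X : ℝ) ^ (7 / 8 : ℝ)) := by ring
  simpa only [hinner, hΛA, hρ] using htot

end Literature.NumberTheory.Sieve.LichtmanTeravainen2022.Liouville
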